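import Summits.Schanuel.Schanuel.Theorems.ZilberEacComplexGraphEscape
import HarnessLib

/-!
# EC by escape over graph bases of arbitrary degree: EC vocabulary and model systems

Companion to `ZilberEacComplexGraphEscape.lean` (Theorem E_D: Exponential-Algebraic Closedness for
`V = {x_{s+1} = g(x'), yⱼ = cⱼ y_{s+1}^{κⱼ} + Σ_{i<κⱼ} A_{j,i}(x') y_{s+1}^i}` over the graph of ANY
polynomial `g` of total degree `D ≥ 2` with `g_D(κ) ≠ 0`; first open rung `dim π₁(V) = n - 1`,
Mantova–Masser, PLMS 129 (2024), §1 p. 5):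

* `graphEscape_inter_expGraph_nonempty` — the statement in the vocabulary of
  `Literature.NumberTheory.Transcendental.expGraph`;
* `cubic_mixedPowers_model_system_solvable` — `∃ z w, e^z = e^{z³+w³} + z ∧ e^w = e^{2(z³+w³)} - w`
  (CUBIC base `x₃ = x₁³ + x₂³`, fibres `y₁ = y₃ + x₁`, `y₂ = y₃² - x₂`; `κ = (1,2)`, `g₃(κ) = 9`);
* `quartic_model_system_solvable` — `∃ z w, e^z = e^{z w³} + w ∧ e^w = e^{z w³} + z`
  (QUARTIC base `x₃ = x₁x₂³`; `κ = (1,1)`, `g₄(κ) = 1`).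

Neither base is quadric, so none of the packet's earlier escape theorems (E, E^κ, E^L) applies, and no
lattice-direction / sign condition (Theorems A, A₀, O, R) is assumed.
HONEST FRAMING: explicit members of the open cell EC(3,2); modest sub-rung of EAC; nothing here bears
on Schanuel's conjecture, and EC(3,2) itself stays open.
-/

noncomputable section

open Complex MvPolynomial Metric Set Filter Topology

set_option linter.dupNamespace false

namespace Summit.Schanuel.Schanuel.Theorems

/-- **The escape varieties of arbitrary degree meet the graph of exponentiation** (EC vocabulary):
with `n = s + 1`, the subvariety `V = {x_{s+1} = g(x'), yⱼ = cⱼ y_{s+1}^{κⱼ} + Σ_{i<κⱼ} A_{j,i}(x') y_{s+1}^i}`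
of `ℂⁿ × ℂⁿ` contains a point of `Literature.NumberTheory.Transcendental.expGraph ℂ n` whenever
`deg g ≥ 2`, `g_D(κ) ≠ 0`, `cⱼ ≠ 0`. [cite: MantovaMasser2023, §1 p.5 (the open case
dim π(V) = 2 in ℂ³×ℂˣ³)] -/
theorem graphEscape_inter_expGraph_nonempty {s : ℕ} (g : MvPolynomial (Fin s) ℂ)
    (hD : 2 ≤ g.totalDegree) (κ : Fin s → ℕ)
    (hα : eval (fun j => (κ j : ℂ)) (homogeneousComponent g.totalDegree g) ≠ 0)
    (c : Fin s → ℂ) (hc : ∀ j, c j ≠ 0) (A : Fin s → ℕ → MvPolynomial (Fin s) ℂ) :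
    ({z : Fin (s + 1) ⊕ Fin (s + 1) → ℂ |
        z (Sum.inl (Fin.last s)) = eval (fun j => z (Sum.inl (Fin.castSucc j))) g ∧
        ∀ j : Fin s, z (Sum.inr (Fin.castSucc j)) =
          c j * z (Sum.inr (Fin.last s)) ^ (κ j) +
            ∑ i ∈ Finset.range (κ j), eval (fun l => z (Sum.inl (Fin.castSucc l))) (A j i) *
              z (Sum.inr (Fin.last s)) ^ i} ∩
      Literature.NumberTheory.Transcendental.expGraph ℂ (s + 1)).Nonempty := by
  obtain ⟨x, hx⟩ := exists_expPoint_graphEscape g hD κ hα c hc A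
  set X : Fin (s + 1) → ℂ := Fin.snoc x (eval x g) with hX
  refine ⟨Sum.elim X fun i => exp (X i), ⟨?_, fun j => ?_⟩, fun i => ?_⟩
  · simp only [Sum.elim_inl, hX, Fin.snoc_last, Fin.snoc_castSucc]
  · simp only [Sum.elim_inl, Sum.elim_inr, hX, Fin.snoc_castSucc, Fin.snoc_last]
    exact hx j
  · simp [Literature.ModelTheory.ExponentialFields.ExponentialRing.complex_exp_eq]

/-! ### Model systems over bases of degree three and four -/

/-- **A cubic model system with mixed powers is solvable**: there are `z, w ∈ ℂ` with
`e^z = e^{z³+w³} + z` and `e^w = (e^{z³+w³})² - w`, i.e. the 3-fold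
`V = {x₃ = x₁³ + x₂³, y₁ = y₃ + x₁, y₂ = y₃² - x₂} ⊆ ℂ³ × ℂˣ³` (additive projection the cubic
surface `x₃ = x₁³ + x₂³`, `dim π₁ V = 2`: the open case of Mantova–Masser 2024 §1 p. 5) meets the
graph of `exp`. Theorem E_D with `κ = (1,2)`, `g₃(κ) = 1 + 8 = 9 ≠ 0`; no quadric escape theorem and
no lattice-sign theorem of this packet covers the fibre `y₂ = y₃² - x₂` over a cubic base. New.
[cite: MantovaMasser2023, §1 p.5 (the open case dim π(V) = 2 in ℂ³×ℂˣ³)] -/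
theorem cubic_mixedPowers_model_system_solvable :
    ∃ z w : ℂ, exp z = exp (z ^ 3 + w ^ 3) + z ∧ exp w = exp (z ^ 3 + w ^ 3) ^ 2 - w := by
  set g : MvPolynomial (Fin 2) ℂ := X 0 ^ 3 + X 1 ^ 3 with hg
  have hhom : g.IsHomogeneous 3 := (isHomogeneous_X_pow 0 3).add (isHomogeneous_X_pow 1 3)
  have heval : ∀ x : Fin 2 → ℂ, eval x g = x 0 ^ 3 + x 1 ^ 3 := fun x => by
    simp [hg, map_add, map_pow, eval_X]
  have hg0 : g ≠ 0 := by
    intro h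
    have := heval ![1, 0]
    rw [h, map_zero] at this
    norm_num at this
  have hdeg : g.totalDegree = 3 := hhom.totalDegree hg0
  set κ : Fin 2 → ℕ := ![1, 2] with hκdef
  have hκ : ∀ j, 0 < κ j := by
    refine Fin.forall_fin_two.mpr ⟨?_, ?_⟩ <;> simp [hκdef]
  have hα : eval (fun j => (κ j : ℂ)) (homogeneousComponent g.totalDegree g) ≠ 0 := by
    rw [hdeg, homogeneousComponent_eq_self hhom, heval]
    simp [hκdef]
    norm_num
  set A : Fin 2 → MvPolynomial (Fin 2) ℂ := ![X 0, -X 1] with hAdef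
  have hA0 : A 0 = X 0 := by simp [hAdef]
  have hA1 : A 1 = -X 1 := by simp [hAdef]
  obtain ⟨x, hx⟩ := exists_expPoint_graphEscape_powers g (by rw [hdeg]; norm_num) κ hκ hα
    (fun _ => 1) (fun _ => one_ne_zero) A
  have hκ0 : κ 0 = 1 := rfl
  have hκ1 : κ 1 = 2 := rfl
  refine ⟨x 0, x 1, ?_, ?_⟩
  · have h := hx 0
    rw [heval, hA0, eval_X, hκ0, pow_one, one_mul] at h
    exact h
  · have h := hx 1
    rw [heval, hA1, map_neg, eval_X, hκ1, one_mul] at h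
    rw [h]; ring

/-- **A quartic model system is solvable**: there are `z, w ∈ ℂ` with `e^z = e^{z w³} + w` and
`e^w = e^{z w³} + z`, i.e. the 3-fold `V = {x₃ = x₁x₂³, y₁ = y₃ + x₂, y₂ = y₃ + x₁} ⊆ ℂ³ × ℂˣ³`
(additive projection the quartic surface `x₃ = x₁x₂³`, `dim π₁ V = 2`) meets the graph of `exp`.
Theorem E_D with `κ = (1,1)`, `g₄(κ) = 1 ≠ 0`. New.
[cite: MantovaMasser2023, §1 p.5 (the open case dim π(V) = 2 in ℂ³×ℂˣ³)] -/
theorem quartic_model_system_solvable :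
    ∃ z w : ℂ, exp z = exp (z * w ^ 3) + w ∧ exp w = exp (z * w ^ 3) + z := by
  set g : MvPolynomial (Fin 2) ℂ := X 0 * X 1 ^ 3 with hg
  have hhom : g.IsHomogeneous 4 := by
    have h := (isHomogeneous_X ℂ (0 : Fin 2)).mul (isHomogeneous_X_pow (1 : Fin 2) 3)
    simpa using h
  have heval : ∀ x : Fin 2 → ℂ, eval x g = x 0 * x 1 ^ 3 := fun x => by
    simp [hg, map_mul, map_pow, eval_X]
  have hg0 : g ≠ 0 := by
    intro h
    have := heval ![1, 1]
    rw [h, map_zero] at this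
    norm_num at this
  have hdeg : g.totalDegree = 4 := hhom.totalDegree hg0
  set κ : Fin 2 → ℕ := ![1, 1] with hκdef
  have hκ : ∀ j, 0 < κ j := by
    refine Fin.forall_fin_two.mpr ⟨?_, ?_⟩ <;> simp [hκdef]
  have hα : eval (fun j => (κ j : ℂ)) (homogeneousComponent g.totalDegree g) ≠ 0 := by
    rw [hdeg, homogeneousComponent_eq_self hhom, heval]
    simp [hκdef]
  set A : Fin 2 → MvPolynomial (Fin 2) ℂ := ![X 1, X 0] with hAdef
  have hA0 : A 0 = X 1 := by simp [hAdef]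
  have hA1 : A 1 = X 0 := by simp [hAdef]
  obtain ⟨x, hx⟩ := exists_expPoint_graphEscape_powers g (by rw [hdeg]; norm_num) κ hκ hα
    (fun _ => 1) (fun _ => one_ne_zero) A
  have hκ0 : κ 0 = 1 := rfl
  have hκ1 : κ 1 = 1 := rfl
  refine ⟨x 0, x 1, ?_, ?_⟩
  · have h := hx 0
    rw [heval, hA0, eval_X, hκ0, pow_one, one_mul] at h
    exact h
  · have h := hx 1
    rw [heval, hA1, eval_X, hκ1, pow_one, one_mul] at h
    exact h

end Summit.Schanuel.Schanuel.Theorems
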